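import Summits.RiemannHypothesis.RiemannHypothesis.Theses.WeilWindowFlow
import Literature.NumberTheory.LFunctions.WeilMarkovQuadratic
import Literature.NumberTheory.LFunctions.WeilGroundState
import Literature.NumberTheory.LFunctions.WeilSemilocalCompactnessProofs
import Literature.NumberTheory.LFunctions.WeilWindowSuzukiProofs
import Literature.NumberTheory.LFunctions.WeilWindowSuzukiAsymptoticProofs
import Summits.RiemannHypothesis.RiemannHypothesis.Theorems.WeilWindowFlowWindowLipschitzStubFormDomainPos
import Summits.RiemannHypothesis.RiemannHypothesis.Theorems.WeilWindowFlowWindowLipschitzStubGroundStateEnergy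
import Summits.RiemannHypothesis.RiemannHypothesis.Theorems.WeilWindowFlowWindowLipschitzStubEulerLagrange
import Summits.RiemannHypothesis.RiemannHypothesis.Theorems.WeilWindowFlowWindowLipschitzStubSupBound
import Summits.RiemannHypothesis.RiemannHypothesis.Theorems.WeilWindowFlowWindowLipschitzStubLocalizedCut
import Summits.RiemannHypothesis.RiemannHypothesis.Theorems.WeilWindowFlowWindowLipschitzStubBarrierEnergy
import Summits.RiemannHypothesis.RiemannHypothesis.Theorems.WeilWindowFlowWindowLipschitzStubCommutatorBound
import Summits.RiemannHypothesis.RiemannHypothesis.Theorems.WeilWindowFlowWindowLipschitzStubSurplusReduction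
import Summits.RiemannHypothesis.RiemannHypothesis.Theorems.WeilWindowFlowWindowLipschitzStubBarrierWeakForm
import Summits.RiemannHypothesis.RiemannHypothesis.Theorems.WeilWindowFlowWindowLipschitzStubSurplusCalculus
import Summits.RiemannHypothesis.RiemannHypothesis.Theorems.WeilWindowFlowWindowLipschitzStubComparison
import HarnessLib.Audit

/-!
# Line `borderline-barrier` — skeleton for crux `WeilWindowFlow.WindowLipschitz`
(item stmt-RiemannHypothesis-1039, route route-RiemannHypothesis-WeilWindowFlow; rev 2 = SECOND line lead's
reshape, prover-line-stmt-RiemannHypothesis-1039-b-0, 2026-08-16; rev 3 (same day): ALL SIX STUBS LANDED — this file is now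
sorry-free and the crux is closed in the tree by `Theorems/WeilWindowFlowWindowLipschitz.lean` (`WindowLipschitz_proof`, p84280))

Crux (BY NAME, never restated): `Summit.RiemannHypothesis.RiemannHypothesis.Theses.WeilWindowFlow.WindowLipschitz`
= `∀ b₀ A, 0 < b₀ → b₀ ≤ A → ∃ L, ∀ b a, b₀ ≤ b → b ≤ a → a ≤ A → ε b − ε a ≤ L (a − b)`,
`ε = Literature.NumberTheory.LFunctions.weilGroundEnergy`.

## The line (idea card `Cruxes/WindowLipschitz/Ideas/borderline-barrier.md`, line card `Lines/borderline-barrier.md`)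

The Lipschitz bound is the `L²`-shadow of the SHARP pointwise edge law of ground states
`‖u(x)‖² · log(1/(a−|x|)) ≤ K(b₀,A)` (boundary exponent exactly `1/2` for the order-zero archimedean kernel
`ρ = weilArchDensity ~ 1/(2t)`), and the edge law is decided by ONE explicit supersolution, the two-scale profile
`B(x) = (log(1/min(a − |x|, d₀)))^{-1/2}` on the open window (`0` outside), whose archimedean jump operator
`(L B)(y) = ∫₀^∞ (2B(y) − B(y+t) − B(y−t)) ρ(t) dt` has a positive SURPLUS `≥ ¼ √(log 1/d₀)` on the whole edge layer
`a − d₀ < |y| < a` (the critical `½√(log 1/d)` terms of killing and inner pull cancel), plus a weak maximum principle.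

## What changed in rev 2 (second lead) against the planner's rev 1 (6 stubs)

The first lead's line `cut-dont-squeeze` has LANDED the common spine as tree theorems
(`Theorems/WeilWindowFlowWindowLipschitzStub{FormDomainPos,GroundStateEnergy,EulerLagrange,SupBound,LocalizedCut}`,
`…CommutatorBoundAux{,2,3,4}`): they are IMPORTED here, never re-proved (rev 1's `stub_formDomainBound`,
`stub_weakEulerLagrange`, `stub_groundStateSupBound` are thereby discharged, and rev 1's `stub_imsCut` is replaced by
the landed `stub_localizedCut` + the verbatim `stub_commutatorBound` of `cut-dont-squeeze`, through the sorry-free glue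
`oneStep_of` / `lipschitzBound_of_oneStep` / `edgeMassLaw_of_pointwise` copied from that line).  What remains is this
line's own content, the EDGE LAW, cut into five registered stubs with def-free signatures (the barrier enters every
signature as a hypothesis `hB : ∀ x, B x = if |x| < a then 1/√(log(1/min (a−|x|) d₀)) else 0`):

* `stub_surplusReduction` (S1a, M) — `L B(y) ≥ W(d)(½log(1/d) − 1) − J − β₀d₀ − (β₀ − W(d))(½log(1/(d₀−d)) + 3)`
  at depth `d = a − |y| ∈ (0, d₀)`, `W(s) = (log 1/s)^{-1/2}`, `β₀ = W(d₀)`,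
  `J = ∫₀^{d₀−d} (W(d+s) − W(d)) ds/(2s)` (uses only `|ρ(t) − 1/(2t)| ≤ 1` on `(0,1]`, `ρ > 0`,
  `ρ ≤ e^{-t/2}/(1 − e^{-2})` on `[1,∞)`), with integrability of the integrand of `L B(y)`;
* `stub_surplusCalculus` (S1b, M) — the displayed expression is `≥ ¼√(log 1/d₀)` for `d₀ ≤ d₁` (pure calculus:
  `W` increasing and concave on `(0, e^{-3/2})`, `∫ W(σ)dσ/(2σ) = −√(log 1/σ)`, `√(x−e) ≤ √x − e/(2√x)`);
* `stub_barrierEnergy` (S2a, M) — `B` is measurable, `0 ≤ B ≤ β₀`, `B ∈ L²`, finite archimedean energy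
  (`D_t(B) ≲ t/log(1/t)`);
* `stub_barrierWeakForm` (S2b, M/L) — Fubini: a pointwise surplus `L B ≥ c` on the layer gives the WEAK supersolution
  inequality `c ∫ w ≤ ∫₀^∞ ρ(t) ∫ (B(x+t) − B x)(w(x+t) − w x) dx dt` for every `0 ≤ w ∈ L²` vanishing a.e. off the layer;
* `stub_comparison` (S3, L, HARDEST, held by the lead) — weak maximum principle: S2a + S2b (for all small `d₀`) +
  the landed (C2)/(EL)/(A) give the POINTWISE edge law in exactly the shape of `cut-dont-squeeze`'s `stub_edgeLaw`
  conclusion (test the real E–L identity of `Re(ζu)` with `(Re(ζu) − C_sup√(log 1/d₀)·B)₊`, Markov inequality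
  `(Δ Re ζu)(Δw) ≥ K₁ (ΔB)(Δw)`, primes/pole/killing `O(C_sup ∫ w)`, surplus `c K₁ √(log 1/d₀) ∫w` wins for
  `log(1/d₀) > C_F/c`);
* `stub_commutatorBound` (S4 = E of `cut-dont-squeeze`, VERBATIM name + signature, so that the crux registry serves
  both leads; its core `stub_commutatorBound_core` is landed).

Landed: S1a p79895, S1b p81490, S2a p78431, S2b p81528, S3 p82451, S4 p78875 (+ Aux p78450 p78541 p79071 p78393 p80997).
`WindowLipschitz_of : WindowLipschitz` composes: edge law (S3 ∘ S2a ∘ (S2b ∘ S1a ∘ S1b)) → edge-mass law (bridge) →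
commutator bound (S4, with the landed sup bound) → one step (landed `stub_localizedCut`) → local-to-compact glue.

Disproof.lean honoured (refuter-cdisprove-1039, evidence 22:19Z/22:36Z; body not mounted here): every constant lives
on a compact range `[b₀, A]`, `0 < b₀` (`windowLipschitz_false_without_floor`, `lipschitzConstant_unbounded`,
`not_windowLipschitzUniform`; Negative/CutDontSqueezeFloors: `supBound_false_without_floor`,
`edgeMassLaw_false_without_floor`): the edge law asks `d₀ ≤ b₀/2` and inherits the floor through `C_sup(b₀,A)` and
`ε(b₀)`; only TRUE ground states enter (near-miss `not_virialBoundedOnNearMinimisers` untouched); the glue is the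
disprover's `windowLipschitz_iff_locallyLipschitzOn` remark.
-/

set_option linter.dupNamespace false

noncomputable section

open MeasureTheory Set Filter
open scoped Topology ENNReal NNReal

namespace Summit.RiemannHypothesis.RiemannHypothesis.Cruxes.WindowLipschitz.BorderlineBarrier

open Literature.NumberTheory.LFunctions
open Summit.RiemannHypothesis.RiemannHypothesis.Theses.WeilWindowFlow (WindowLipschitz)
open Summit.RiemannHypothesis.RiemannHypothesis.Theorems.WeilWindowFlowWindowLipschitz
  (stub_formDomainPos stub_groundStateEnergy stub_eulerLagrange stub_supBound stub_localizedCut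
    stub_barrierEnergy stub_commutatorBound stub_surplusReduction stub_barrierWeakForm
    stub_surplusCalculus stub_comparison)

/-! ### The five registered stubs of the edge law + the verbatim commutator stub -/

/- Stub S1a `stub_surplusReduction` — LANDED: `Theorems/WeilWindowFlowWindowLipschitzStubSurplusReduction.lean`
   (worker w-S1a, p79895 + Aux p78450, 2026-08-16). -/

/- Stub S1b `stub_surplusCalculus` — LANDED: `Theorems/WeilWindowFlowWindowLipschitzStubSurplusCalculus.lean`
   (worker w-S1b, p81490 + Aux p78541, 2026-08-16). -/

/- Stub S2a `stub_barrierEnergy` — LANDED: `Theorems/WeilWindowFlowWindowLipschitzStubBarrierEnergy.lean`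
   (worker w-S2a, p78431, 2026-08-16); imported and opened above. -/

/- Stub S2b `stub_barrierWeakForm` — LANDED: `Theorems/WeilWindowFlowWindowLipschitzStubBarrierWeakForm.lean`
   (worker w-S2b, p81528 + Aux p79071, 2026-08-16). -/

/- Stub S3 `stub_comparison` — LANDED: `Theorems/WeilWindowFlowWindowLipschitzStubComparison.lean`
   (second lead, p82451 + Aux p78393 + Phase p80997, 2026-08-16). -/

/- Stub S4 `stub_commutatorBound` — LANDED: `Theorems/WeilWindowFlowWindowLipschitzStubCommutatorBound.lean`
   (second lead, p78875, 2026-08-16; wrapper around the first lead's landed `stub_commutatorBound_core`). -/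

/-! ### Bridge to the pointwise edge law (sorry-free; NOT a stub) -/

/-- **The pointwise edge law implies the edge-mass law (Stub B's conclusion).**  If on `[b₀, A]` every ground
state satisfies `‖u(x)‖² · log(1/(a − |x|)) ≤ K` for a.e. `x` with `a − d₀ < |x| < a` (the `C⁺` of the sibling
lines `ladder-height-edge-law` (`stub_exitTime`/`stub_cut`) and rev 2 of this line; `borderline-barrier`'s
`log(4A/(a−|x|))` variant implies it), then `∫_{a−r<|x|} ‖u‖² ≤ 2 max(K,0) · r / log(1/r)` for `0 < r ≤ d₀`:
`u = 0` a.e. off `[−a, a]` (`IsWeilGroundState.ae_eq_zero_of_notMem`), the layer `{a − r < |x| ≤ a}` has measure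
`2r`, and on it `log(1/(a−|x|)) ≥ log(1/r) > 0`.  So a worker holding ANY pointwise engine discharges Stub B by
`exact edgeMassLaw_of_pointwise h`. -/
theorem edgeMassLaw_of_pointwise
    (hP : ∀ b₀ A : ℝ, 0 < b₀ → b₀ ≤ A → ∃ K d₀ : ℝ, 0 < d₀ ∧ d₀ < 1 ∧
      ∀ (a : ℝ) (u : ℝ → ℂ), b₀ ≤ a → a ≤ A → IsWeilGroundState a u →
        ∀ᵐ x : ℝ, a - d₀ < |x| → |x| < a → ‖u x‖ ^ 2 * Real.log (1 / (a - |x|)) ≤ K) :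
    ∀ b₀ A : ℝ, 0 < b₀ → b₀ ≤ A → ∃ K d₀ : ℝ, 0 < d₀ ∧ d₀ < 1 ∧
      ∀ (a r : ℝ) (u : ℝ → ℂ), b₀ ≤ a → a ≤ A → IsWeilGroundState a u → 0 < r → r ≤ d₀ →
        ∫ x in {x : ℝ | a - r < |x|}, ‖u x‖ ^ 2 ≤ K * r / Real.log (1 / r) := by
  intro b₀ A hb₀ hb₀A
  obtain ⟨K, d₀, hd₀, hd₀1, hK⟩ := hP b₀ A hb₀ hb₀A
  refine ⟨2 * max K 0, d₀, hd₀, hd₀1, ?_⟩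
  intro a r u ha haA hu hr hrd
  have hr1 : r < 1 := lt_of_le_of_lt hrd hd₀1
  have hlogr : 0 < Real.log (1 / r) := by
    apply Real.log_pos
    rw [lt_div_iff₀ hr, one_mul]
    exact hr1
  have hc0 : 0 ≤ max K 0 / Real.log (1 / r) := div_nonneg (le_max_right _ _) hlogr.le
  have hSm : MeasurableSet {x : ℝ | a - r < |x|} :=
    (isOpen_lt continuous_const continuous_abs).measurableSet
  -- Step 1: the integral over the (infinite-measure) set is the integral over its trace on the window
  have hind : ∀ᵐ x : ℝ, ‖u x‖ ^ 2 = (Icc (-a) a).indicator (fun x ↦ ‖u x‖ ^ 2) x := by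
    filter_upwards [hu.ae_eq_zero_of_notMem] with x hx
    by_cases hm : x ∈ Icc (-a) a
    · simp [hm]
    · simp [hm, hx hm]
  have hST : ∫ x in {x : ℝ | a - r < |x|}, ‖u x‖ ^ 2 =
      ∫ x in {x : ℝ | a - r < |x|} ∩ Icc (-a) a, ‖u x‖ ^ 2 := by
    rw [integral_congr_ae (ae_restrict_of_ae hind), setIntegral_indicator measurableSet_Icc]
  -- Step 2: the trace has measure at most `2r`
  have hTsub : {x : ℝ | a - r < |x|} ∩ Icc (-a) a ⊆ Icc (a - r) a ∪ Icc (-a) (-(a - r)) := by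
    intro x hx
    obtain ⟨hxS, hxI⟩ := hx
    simp only [mem_setOf_eq] at hxS
    rcases le_or_gt 0 x with h0 | h0
    · left
      rw [abs_of_nonneg h0] at hxS
      exact ⟨hxS.le, hxI.2⟩
    · right
      rw [abs_of_neg h0] at hxS
      exact ⟨hxI.1, by linarith⟩
  have hUfin : volume (Icc (a - r) a ∪ Icc (-a) (-(a - r))) < ∞ :=
    lt_of_le_of_lt (measure_union_le _ _)
      (by simp [Real.volume_Icc] : volume (Icc (a - r) a) + volume (Icc (-a) (-(a - r))) < ∞)
  have hTfin : volume ({x : ℝ | a - r < |x|} ∩ Icc (-a) a) < ∞ := (measure_mono hTsub).trans_lt hUfin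
  have hTreal : volume.real ({x : ℝ | a - r < |x|} ∩ Icc (-a) a) ≤ 2 * r := by
    calc volume.real ({x : ℝ | a - r < |x|} ∩ Icc (-a) a)
        ≤ volume.real (Icc (a - r) a ∪ Icc (-a) (-(a - r))) := measureReal_mono hTsub hUfin.ne
      _ ≤ volume.real (Icc (a - r) a) + volume.real (Icc (-a) (-(a - r))) := measureReal_union_le _ _
      _ = r + r := by
          rw [Real.volume_real_Icc_of_le (by linarith), Real.volume_real_Icc_of_le (by linarith)]
          ring
      _ = 2 * r := by ring
  -- Step 3: a.e. on the trace, `‖u x‖² ≤ max K 0 / log(1/r)`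
  have hbd : ∀ᵐ x : ℝ, x ∈ {x : ℝ | a - r < |x|} ∩ Icc (-a) a →
      ‖(‖u x‖ ^ 2 : ℝ)‖ ≤ max K 0 / Real.log (1 / r) := by
    filter_upwards [hK a u ha haA hu, Measure.ae_ne volume a, Measure.ae_ne volume (-a)]
      with x hx hxa hxna
    intro hxT
    obtain ⟨hxS, hxI⟩ := hxT
    simp only [mem_setOf_eq] at hxS
    rw [Real.norm_of_nonneg (by positivity)]
    have hxa' : |x| < a := by
      rcases (abs_le.2 ⟨hxI.1, hxI.2⟩).lt_or_eq with hlt | heq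
      · exact hlt
      · exfalso
        rcases le_or_gt 0 x with h0 | h0
        · rw [abs_of_nonneg h0] at heq
          exact hxa heq
        · rw [abs_of_neg h0] at heq
          exact hxna (by linarith)
    have hd : 0 < a - |x| := sub_pos.2 hxa'
    have hdr : a - |x| < r := by linarith
    have hlogx : Real.log (1 / r) ≤ Real.log (1 / (a - |x|)) :=
      Real.log_le_log (by positivity) (one_div_le_one_div_of_le hd hdr.le)
    have hlogx0 : 0 < Real.log (1 / (a - |x|)) := hlogr.trans_le hlogx
    have h1 : ‖u x‖ ^ 2 * Real.log (1 / (a - |x|)) ≤ K := hx (by linarith) hxa'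
    have h2 : ‖u x‖ ^ 2 * Real.log (1 / (a - |x|)) ≤ max K 0 := h1.trans (le_max_left _ _)
    calc ‖u x‖ ^ 2 ≤ max K 0 / Real.log (1 / (a - |x|)) := by
          rw [le_div_iff₀ hlogx0]
          exact h2
      _ ≤ max K 0 / Real.log (1 / r) :=
          div_le_div_of_nonneg_left (le_max_right _ _) hlogr hlogx
  -- Step 4: assemble
  have hnorm := norm_setIntegral_le_of_norm_le_const_ae' hTfin hbd
  rw [hST]
  calc ∫ x in {x : ℝ | a - r < |x|} ∩ Icc (-a) a, ‖u x‖ ^ 2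
      ≤ ‖∫ x in {x : ℝ | a - r < |x|} ∩ Icc (-a) a, ‖u x‖ ^ 2‖ := Real.le_norm_self _
    _ ≤ max K 0 / Real.log (1 / r) * volume.real ({x : ℝ | a - r < |x|} ∩ Icc (-a) a) := hnorm
    _ ≤ max K 0 / Real.log (1 / r) * (2 * r) := mul_le_mul_of_nonneg_left hTreal hc0
    _ = 2 * max K 0 * r / Real.log (1 / r) := by ring


/-! ### Sorry-free glue -/

/-- Antitonicity of the window bottom: a larger window has a smaller bottom (`sInf` over a larger, still
bounded-below set; the smaller sphere is nonempty).  Proved here so that the composition below is sorry-free;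
the disprover's `weilGroundEnergy_antitone` (Disproof.lean) is the same statement. -/
theorem weilGroundEnergy_antitone {a b : ℝ} (hb : 0 < b) (hba : b ≤ a) :
    weilGroundEnergy a ≤ weilGroundEnergy b := by
  obtain ⟨g, hg, hs, hn⟩ := exists_isWeilTest_sphere hb
  refine le_csInf ⟨_, g, hg, hs, hn, rfl⟩ ?_
  rintro x ⟨h, hh, hhs, hhn, rfl⟩
  exact csInf_le (bddBelow_weilQuadratic_sphere_holds a)
    ⟨h, hh, hhs.trans (Icc_subset_Icc (neg_le_neg hba) hba), hhn, rfl⟩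

/-- **The one-step bound from the statements of (D) and (E)** (sorry-free; hypotheses are the stub STATEMENTS,
conclusion is NOT the crux).  For `a ∈ [b₀, A]` and `0 < h ≤ h₁ := min h₀ (b₀/2)` take a ground state `u` of the
window `a` (`ConnesConsaniMoscovici2025_thm_3_6_holds.exists_isWeilGroundState`, PROVED in the tree) and the
piecewise-linear cutoff `χ(x) = max (min ((a − h − |x|)/h) 1) 0`; (D) at `b = a − h` and (E) give
`(ε(a−h) − ε(a)) · ∫‖χu‖² ≤ C h` with `∫‖χu‖² ≥ 1/2`, and `ε(a−h) ≥ ε(a)` (antitone), so `ε(a−h) − ε(a) ≤ 2Ch`. -/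
theorem oneStep_of
    (hD : (∀ (a b : ℝ) (K : ℝ≥0) (u : ℝ → ℂ) (χ : ℝ → ℝ), 0 < b → b ≤ a → IsWeilGroundState a u →
        LipschitzWith K χ → (∀ x, 0 ≤ χ x ∧ χ x ≤ 1) → (∀ x, b ≤ |x| → χ x = 0) →
        (weilGroundEnergy b - weilGroundEnergy a) * ∫ x, ‖(χ x : ℂ) * u x‖ ^ 2 ≤
          (∫ t in Ioi (0 : ℝ), weilArchDensity t *
              ∫ x, (χ (x + t) - χ x) ^ 2 * (‖u (x + t)‖ * ‖u x‖)) +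
          (∑ n ∈ weilPrimeIndex a, (ArithmeticFunction.vonMangoldt n : ℝ) / Real.sqrt n *
              ∫ x, (χ (x + Real.log n) - χ x) ^ 2 * (‖u (x + Real.log n)‖ * ‖u x‖)) +
          2 * ‖∫ t, ((1 - χ t : ℝ) : ℂ) * u t * (Real.cosh (t / 2) : ℂ)‖ ^ 2 +
          2 * ‖∫ t, u t * (Real.cosh (t / 2) : ℂ)‖ *
              ‖∫ t, (((1 - χ t) ^ 2 : ℝ) : ℂ) * u t * (Real.cosh (t / 2) : ℂ)‖ +
          2 * ‖∫ t, u t * (Real.sinh (t / 2) : ℂ)‖ *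
              ‖∫ t, (((1 - χ t) ^ 2 : ℝ) : ℂ) * u t * (Real.sinh (t / 2) : ℂ)‖))
    (hEst : (∀ b₀ A : ℝ, 0 < b₀ → b₀ ≤ A → ∃ C h₀ : ℝ, 0 < h₀ ∧
        ∀ (a h : ℝ) (u : ℝ → ℂ) (χ : ℝ → ℝ), b₀ ≤ a → a ≤ A → 0 < h → h ≤ h₀ →
        IsWeilGroundState a u → (∀ x y, |χ x - χ y| ≤ |x - y| / h) → (∀ x, 0 ≤ χ x ∧ χ x ≤ 1) →
        (∀ x, |x| ≤ a - 2 * h → χ x = 1) → (∀ x, a - h ≤ |x| → χ x = 0) →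
        (∫ t in Ioi (0 : ℝ), weilArchDensity t *
              ∫ x, (χ (x + t) - χ x) ^ 2 * (‖u (x + t)‖ * ‖u x‖)) +
          (∑ n ∈ weilPrimeIndex a, (ArithmeticFunction.vonMangoldt n : ℝ) / Real.sqrt n *
              ∫ x, (χ (x + Real.log n) - χ x) ^ 2 * (‖u (x + Real.log n)‖ * ‖u x‖)) +
          2 * ‖∫ t, ((1 - χ t : ℝ) : ℂ) * u t * (Real.cosh (t / 2) : ℂ)‖ ^ 2 +
          2 * ‖∫ t, u t * (Real.cosh (t / 2) : ℂ)‖ *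
              ‖∫ t, (((1 - χ t) ^ 2 : ℝ) : ℂ) * u t * (Real.cosh (t / 2) : ℂ)‖ +
          2 * ‖∫ t, u t * (Real.sinh (t / 2) : ℂ)‖ *
              ‖∫ t, (((1 - χ t) ^ 2 : ℝ) : ℂ) * u t * (Real.sinh (t / 2) : ℂ)‖ ≤ C * h ∧
          1 / 2 ≤ ∫ x, ‖(χ x : ℂ) * u x‖ ^ 2)) :
    ∀ b₀ A : ℝ, 0 < b₀ → b₀ ≤ A → ∃ C h₁ : ℝ, 0 < h₁ ∧ h₁ ≤ b₀ / 2 ∧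
      ∀ a h : ℝ, b₀ ≤ a → a ≤ A → 0 < h → h ≤ h₁ →
        weilGroundEnergy (a - h) - weilGroundEnergy a ≤ C * h := by
  intro b₀ A hb₀ hb₀A
  obtain ⟨C, h₀, hh₀, hest⟩ := hEst b₀ A hb₀ hb₀A
  -- shrink the admissible width so that the small window `a - h` stays positive (the floor `0 < b₀` is used here)
  set h₁ : ℝ := min h₀ (b₀ / 2) with hh₁def
  have hh₁ : 0 < h₁ := lt_min hh₀ (by linarith)
  have hh₁₀ : h₁ ≤ h₀ := min_le_left _ _
  have hh₁b : h₁ ≤ b₀ / 2 := min_le_right _ _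
  refine ⟨2 * max C 0, h₁, hh₁, hh₁b, ?_⟩
  intro a h ha haA hh hhle
  have ha0 : 0 < a := lt_of_lt_of_le hb₀ ha
  have hb : 0 < a - h := by linarith
  obtain ⟨u, hu⟩ := ConnesConsaniMoscovici2025_thm_3_6_holds.exists_isWeilGroundState ha0
  -- the piecewise-linear cutoff of width `h`
  set χ : ℝ → ℝ := fun x ↦ max (min ((a - h - |x|) / h) 1) 0 with hχdef
  have hχ01 : ∀ x, 0 ≤ χ x ∧ χ x ≤ 1 := fun x ↦
    ⟨le_max_right _ _, max_le (min_le_right _ _) zero_le_one⟩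
  have hχone : ∀ x, |x| ≤ a - 2 * h → χ x = 1 := by
    intro x hx
    have h1p : 1 ≤ (a - h - |x|) / h := by
      rw [le_div_iff₀ hh]
      linarith
    show max (min ((a - h - |x|) / h) 1) 0 = 1
    rw [min_eq_right h1p, max_eq_left (zero_le_one' ℝ)]
  have hχzero : ∀ x, a - h ≤ |x| → χ x = 0 := by
    intro x hx
    have hp : (a - h - |x|) / h ≤ 0 := by
      rw [div_le_iff₀ hh, zero_mul]
      linarith
    show max (min ((a - h - |x|) / h) 1) 0 = 0
    exact max_eq_right ((min_le_left _ _).trans hp)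
  have hχlip : ∀ x y, |χ x - χ y| ≤ |x - y| / h := by
    intro x y
    calc |χ x - χ y|
        = |max (min ((a - h - |x|) / h) 1) 0 - max (min ((a - h - |y|) / h) 1) 0| := rfl
      _ ≤ |min ((a - h - |x|) / h) 1 - min ((a - h - |y|) / h) 1| := abs_max_sub_max_le_abs _ _ _
      _ ≤ max |(a - h - |x|) / h - (a - h - |y|) / h| |(1 : ℝ) - 1| := abs_min_sub_min_le_max _ _ _ _
      _ = |(a - h - |x|) / h - (a - h - |y|) / h| := by
          rw [sub_self, abs_zero, max_eq_left (abs_nonneg _)]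
      _ = |(|y| - |x|)| / h := by
          rw [show (a - h - |x|) / h - (a - h - |y|) / h = (|y| - |x|) / h by ring, abs_div,
            abs_of_pos hh]
      _ ≤ |x - y| / h := by
          rw [div_le_div_iff_of_pos_right hh, abs_sub_comm x y]
          exact abs_abs_sub_abs_le_abs_sub y x
  have hχLW : LipschitzWith (Real.toNNReal (1 / h)) χ := by
    refine LipschitzWith.of_dist_le_mul fun x y ↦ ?_
    rw [Real.dist_eq, Real.dist_eq, Real.coe_toNNReal _ (by positivity)]
    calc |χ x - χ y| ≤ |x - y| / h := hχlip x y
      _ = 1 / h * |x - y| := by ring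
  -- (D) at `b = a - h` and (E)
  have hcut := hD a (a - h) (Real.toNNReal (1 / h)) u χ hb (by linarith) hu hχLW hχ01 hχzero
  obtain ⟨hR, hm⟩ := hest a h u χ ha haA hh (hhle.trans hh₁₀) hu hχlip hχ01 hχone hχzero
  have hanti : 0 ≤ weilGroundEnergy (a - h) - weilGroundEnergy a :=
    sub_nonneg.2 (weilGroundEnergy_antitone hb (by linarith))
  have h1 : (weilGroundEnergy (a - h) - weilGroundEnergy a) * (1 / 2) ≤ C * h :=
    le_trans (mul_le_mul_of_nonneg_left hm hanti) (hcut.trans hR)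
  have h2 : C * h ≤ max C 0 * h := mul_le_mul_of_nonneg_right (le_max_left C 0) hh.le
  linarith

/-- **Local-to-compact glue** (sorry-free; the "local-to-compact is free" step of the disprover's
`windowLipschitz_iff_locallyLipschitzOn`): a one-step bound `ε(a−h) − ε(a) ≤ C h` for `0 < h ≤ h₁` on `[b₀, A]`
gives the Lipschitz bound with `L := max C 0 + |ε(b₀) − ε(A)|/h₁`; gaps `a − b > h₁` are paid by antitonicity,
`ε(b) − ε(a) ≤ ε(b₀) − ε(A) ≤ |ε(b₀) − ε(A)|/h₁ · (a − b)`. -/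
theorem lipschitzBound_of_oneStep {b₀ A C h₁ : ℝ} (hb₀ : 0 < b₀) (hh₁ : 0 < h₁)
    (hstep : ∀ a h : ℝ, b₀ ≤ a → a ≤ A → 0 < h → h ≤ h₁ →
      weilGroundEnergy (a - h) - weilGroundEnergy a ≤ C * h) :
    ∃ L : ℝ, ∀ b a : ℝ, b₀ ≤ b → b ≤ a → a ≤ A →
      weilGroundEnergy b - weilGroundEnergy a ≤ L * (a - b) := by
  set M : ℝ := |weilGroundEnergy b₀ - weilGroundEnergy A| with hM
  have hM0 : 0 ≤ M := abs_nonneg _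
  have hMh : 0 ≤ M / h₁ := div_nonneg hM0 hh₁.le
  refine ⟨max C 0 + M / h₁, ?_⟩
  intro b a hb hba haA
  have hb0 : 0 < b := lt_of_lt_of_le hb₀ hb
  have ha0 : 0 < a := lt_of_lt_of_le hb0 hba
  rcases eq_or_lt_of_le hba with heq | hlt
  · subst heq
    simp
  · by_cases hsmall : a - b ≤ h₁
    · have hpos : 0 < a - b := sub_pos.2 hlt
      have h1 := hstep a (a - b) (le_trans hb hba) haA hpos hsmall
      rw [sub_sub_cancel] at h1
      calc weilGroundEnergy b - weilGroundEnergy a ≤ C * (a - b) := h1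
        _ ≤ (max C 0 + M / h₁) * (a - b) := by
            apply mul_le_mul_of_nonneg_right _ hpos.le
            linarith [le_max_left C 0]
    · have hlarge : h₁ < a - b := lt_of_not_ge hsmall
      have e1 : weilGroundEnergy b ≤ weilGroundEnergy b₀ := weilGroundEnergy_antitone hb₀ hb
      have e2 : weilGroundEnergy A ≤ weilGroundEnergy a := weilGroundEnergy_antitone ha0 haA
      have h2 : weilGroundEnergy b - weilGroundEnergy a ≤ M :=
        le_trans (by linarith) (le_abs_self _)
      calc weilGroundEnergy b - weilGroundEnergy a ≤ M := h2
        _ = (M / h₁) * h₁ := by field_simp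
        _ ≤ (M / h₁) * (a - b) := mul_le_mul_of_nonneg_left hlarge.le hMh
        _ ≤ (max C 0 + M / h₁) * (a - b) := by
            apply mul_le_mul_of_nonneg_right _ (sub_nonneg.2 hba)
            linarith [le_max_right C 0]


/-! ### The composition (concludes the crux BY NAME; the six stubs enter BY NAME) -/

/-- The pointwise surplus on the whole layer, from S1a and S1b: for `d₀ ≤ d₁`, `d₀ < a` and `a − d₀ < |y| < a`,
the integrand of `(L B)(y)` is integrable and `(L B)(y) ≥ ¼ √(log 1/d₀)`. -/
theorem surplus_of_reduction_calculus
    (hS1a : ∀ (a d₀ d : ℝ) (B : ℝ → ℝ), 0 < d → d < d₀ → 2 * d₀ ≤ 1 → d₀ < a →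
      (∀ x, B x = if |x| < a then 1 / Real.sqrt (Real.log (1 / min (a - |x|) d₀)) else 0) →
      ∀ y : ℝ, |y| = a - d →
        IntegrableOn (fun t ↦ (2 * B y - B (y + t) - B (y - t)) * weilArchDensity t) (Ioi 0) ∧
        1 / Real.sqrt (Real.log (1 / d)) * (Real.log (1 / d) / 2 - 1)
            - (∫ s in (0 : ℝ)..(d₀ - d),
                (1 / Real.sqrt (Real.log (1 / (d + s))) - 1 / Real.sqrt (Real.log (1 / d))) / (2 * s))
            - d₀ / Real.sqrt (Real.log (1 / d₀))
            - (1 / Real.sqrt (Real.log (1 / d₀)) - 1 / Real.sqrt (Real.log (1 / d))) *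
                (Real.log (1 / (d₀ - d)) / 2 + 3)
          ≤ ∫ t in Ioi (0 : ℝ), (2 * B y - B (y + t) - B (y - t)) * weilArchDensity t)
    (hS1b : ∃ d₁ : ℝ, 0 < d₁ ∧ 2 * d₁ ≤ 1 ∧ ∀ d₀ d : ℝ, 0 < d → d < d₀ → d₀ ≤ d₁ →
      1 / 4 * Real.sqrt (Real.log (1 / d₀)) ≤
        1 / Real.sqrt (Real.log (1 / d)) * (Real.log (1 / d) / 2 - 1)
          - (∫ s in (0 : ℝ)..(d₀ - d),
              (1 / Real.sqrt (Real.log (1 / (d + s))) - 1 / Real.sqrt (Real.log (1 / d))) / (2 * s))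
          - d₀ / Real.sqrt (Real.log (1 / d₀))
          - (1 / Real.sqrt (Real.log (1 / d₀)) - 1 / Real.sqrt (Real.log (1 / d))) *
              (Real.log (1 / (d₀ - d)) / 2 + 3)) :
    ∃ d₁ : ℝ, 0 < d₁ ∧ 2 * d₁ ≤ 1 ∧ ∀ (a d₀ : ℝ) (B : ℝ → ℝ), 0 < d₀ → d₀ ≤ d₁ → d₀ < a →
      (∀ x, B x = if |x| < a then 1 / Real.sqrt (Real.log (1 / min (a - |x|) d₀)) else 0) →
      ∀ y : ℝ, a - d₀ < |y| → |y| < a →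
        IntegrableOn (fun t ↦ (2 * B y - B (y + t) - B (y - t)) * weilArchDensity t) (Ioi 0) ∧
          1 / 4 * Real.sqrt (Real.log (1 / d₀)) ≤
            ∫ t in Ioi (0 : ℝ), (2 * B y - B (y + t) - B (y - t)) * weilArchDensity t := by
  obtain ⟨d₁, hd₁, hd₁1, hcalc⟩ := hS1b
  refine ⟨d₁, hd₁, hd₁1, fun a d₀ B hd₀ hd₀₁ hd₀a hB y hy1 hy2 ↦ ?_⟩
  have hd : 0 < a - |y| := sub_pos.2 hy2
  have hdd₀ : a - |y| < d₀ := by linarith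
  have h2d₀ : 2 * d₀ ≤ 1 := by linarith
  obtain ⟨hint, hle⟩ := hS1a a d₀ (a - |y|) B hd hdd₀ h2d₀ hd₀a hB y (by ring)
  exact ⟨hint, (hcalc d₀ (a - |y|) hd hdd₀ hd₀₁).trans hle⟩

/-- The weak surplus for all small `d₀`, from the pointwise surplus and S2b (with `c = 1/4`). -/
theorem weakSurplus_of
    (hS : ∃ d₁ : ℝ, 0 < d₁ ∧ 2 * d₁ ≤ 1 ∧ ∀ (a d₀ : ℝ) (B : ℝ → ℝ), 0 < d₀ → d₀ ≤ d₁ → d₀ < a →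
      (∀ x, B x = if |x| < a then 1 / Real.sqrt (Real.log (1 / min (a - |x|) d₀)) else 0) →
      ∀ y : ℝ, a - d₀ < |y| → |y| < a →
        IntegrableOn (fun t ↦ (2 * B y - B (y + t) - B (y - t)) * weilArchDensity t) (Ioi 0) ∧
          1 / 4 * Real.sqrt (Real.log (1 / d₀)) ≤
            ∫ t in Ioi (0 : ℝ), (2 * B y - B (y + t) - B (y - t)) * weilArchDensity t)
    (hS2b : ∀ (a d₀ c : ℝ) (B : ℝ → ℝ), 0 < d₀ → 2 * d₀ ≤ 1 → d₀ < a →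
      (∀ x, B x = if |x| < a then 1 / Real.sqrt (Real.log (1 / min (a - |x|) d₀)) else 0) →
      (∀ y : ℝ, a - d₀ < |y| → |y| < a →
        IntegrableOn (fun t ↦ (2 * B y - B (y + t) - B (y - t)) * weilArchDensity t) (Ioi 0) ∧
          c ≤ ∫ t in Ioi (0 : ℝ), (2 * B y - B (y + t) - B (y - t)) * weilArchDensity t) →
      ∀ w : ℝ → ℝ, MemLp w 2 → (∀ᵐ x : ℝ, 0 ≤ w x) →
        (∀ᵐ x : ℝ, ¬(a - d₀ < |x| ∧ |x| < a) → w x = 0) →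
        c * ∫ x, w x ≤
          ∫ t in Ioi (0 : ℝ), weilArchDensity t * ∫ x, (B (x + t) - B x) * (w (x + t) - w x)) :
    ∃ c d₁ : ℝ, 0 < c ∧ 0 < d₁ ∧ 2 * d₁ ≤ 1 ∧ ∀ (a d₀ : ℝ) (B : ℝ → ℝ), 0 < d₀ → d₀ ≤ d₁ → d₀ < a →
      (∀ x, B x = if |x| < a then 1 / Real.sqrt (Real.log (1 / min (a - |x|) d₀)) else 0) →
      ∀ w : ℝ → ℝ, MemLp w 2 → (∀ᵐ x : ℝ, 0 ≤ w x) →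
        (∀ᵐ x : ℝ, ¬(a - d₀ < |x| ∧ |x| < a) → w x = 0) →
        c * Real.sqrt (Real.log (1 / d₀)) * ∫ x, w x ≤
          ∫ t in Ioi (0 : ℝ), weilArchDensity t * ∫ x, (B (x + t) - B x) * (w (x + t) - w x) := by
  obtain ⟨d₁, hd₁, hd₁1, hS⟩ := hS
  refine ⟨1 / 4, d₁, by norm_num, hd₁, hd₁1, fun a d₀ B hd₀ hd₀₁ hd₀a hB w hw hw0 hws ↦ ?_⟩
  exact hS2b a d₀ (1 / 4 * Real.sqrt (Real.log (1 / d₀))) B hd₀ (by linarith) hd₀a hB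
    (hS a d₀ B hd₀ hd₀₁ hd₀a hB) w hw hw0 hws

/-- **`WindowLipschitz` from the six registered stubs** — the skeleton's crux proof term.  Landed inputs (first
lead's line `cut-dont-squeeze`, imported): (C1) `stub_formDomainPos`, (C2) `stub_groundStateEnergy`,
(EL) `stub_eulerLagrange C1 C2`, (A) `stub_supBound C2 EL`, (D) `stub_localizedCut C1 C2 EL`.  This line's stubs:
pointwise surplus `surplus_of_reduction_calculus S1a S1b`, weak surplus `weakSurplus_of · S2b`, edge law (P)
`stub_comparison S2a ·`, (B) `edgeMassLaw_of_pointwise P` (sorry-free bridge), (E) `stub_commutatorBound A B`;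
`oneStep_of D E` and `lipschitzBound_of_oneStep` are the local-to-compact glue.  No hypotheses; `sorry` only
inside the six `stub_*`. -/
theorem WindowLipschitz_of : WindowLipschitz := by
  have hC1 := stub_formDomainPos
  have hC2 := stub_groundStateEnergy
  have hEL := stub_eulerLagrange hC1 hC2
  have hA := stub_supBound hC2 hEL
  have hS := surplus_of_reduction_calculus stub_surplusReduction stub_surplusCalculus
  have hW := weakSurplus_of hS stub_barrierWeakForm
  have hP := stub_comparison stub_barrierEnergy hW
  have hB := edgeMassLaw_of_pointwise hP
  have hD := stub_localizedCut hC1 hC2 hEL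
  have hE := stub_commutatorBound hA hB
  intro b₀ A hb₀ hb₀A
  obtain ⟨C, h₁, hh₁, -, hstep⟩ := oneStep_of hD hE b₀ A hb₀ hb₀A
  exact lipschitzBound_of_oneStep hb₀ hh₁ hstep

end Summit.RiemannHypothesis.RiemannHypothesis.Cruxes.WindowLipschitz.BorderlineBarrier

end
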